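import Literature.AlgebraicGeometry.HodgeTheory.MiddleDimensionReductionOfHodgeModels
import Literature.AlgebraicGeometry.HodgeTheory.CupPreservesHodgeTypeOfDeRham
import Literature.AlgebraicGeometry.HodgeTheory.HodgeModelExistenceDischarge
import Literature.AlgebraicGeometry.HodgeTheory.HodgeFiltrationModelsRigidity
import HarnessLib

/-!
# Reduction of the Hodge conjecture to the middle dimension: the trust base of BFNP Lemma 48

Family `hodge`, layer `Literature/AlgebraicGeometry/HodgeTheory`. Leaf companion (imported by no
other file, so that the heavy proof files can be gathered here) of the named fact
`middleDimensionReduction` (file `MiddleDimensionReduction`; P. Brosnan, H. Fang, Z. Nie,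
G. Pearlstein, *Singularities of admissible normal functions*, Invent. Math. 177 (2009), §6
**Lemma 48**, arXiv:0711.0964 p. 13: "The following two statements are equivalent: • The Hodge
conjecture holds for all smooth projective complex varieties `Y`. • For every smooth projective
complex variety `X` of dimension `2n` with `n ∈ ℤ`, `(Alg^n X)^⊥ = 0`."; printed proof: products
`Y × ℙ^{2k − dim Y}` and the projection formula below the middle, Bertini and weak Lefschetz above).

The reduction itself is formalised in the companions `MiddleDimensionReductionProofs` (relative to
a Gysin formalism), `MiddleDimensionReductionOfHodgeModels` (with the tree's constructed Gysin maps
`complexGysin`, Poincaré duality, supports and Thom–Gysin exactness — all theorems),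
`CupPreservesHodgeTypeOfDeRham` (the Hodge bidegree of cup products from de Rham's theorem in its
multiplicative form) and `MiddleDimensionReductionOfDeRham`
(`middleDimensionReduction_of_exists_deRhamIsoFamily hA hI hdR`: the named fact from the three
named facts `nonempty_hodgeModel`, `hodgePQ_independent_of_hodgeModel`, `exists_deRhamIsoFamily`).
Two of those three hypotheses are themselves assembled facts whose reductions are theorems of the
tree:

* `nonempty_hodgeModel n X` ⟸ de Rham's theorem for the finite-dimensional complex model spaces
  and the Hodge decomposition of compact Kähler manifolds
  (`nonempty_hodgeModel_of_deRham_of_hodgeDecomposition`, file `HodgeModelExistenceDischarge`: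
  Serre's analytification and "projective ⟹ Kähler" being theorems);
* `hodgePQ_independent_of_hodgeModel` ⟸ the rigidity of natural de Rham comparisons
  (`hodgePQ_independent_of_hodgeModel_of_naturalDeRhamComparisonRigidity`, file
  `HodgeFiltrationModelsRigidity`: uniqueness of the analytification and "`φ^*` is a morphism of
  Hodge structures" being theorems).

This file composes them (importing the two parents of `MiddleDimensionReductionOfDeRham` rather
than that file, so as to stay independent of it), so that the TRUST BASE of `middleDimensionReduction` is explicit and
minimal in the tree's present state — exactly three root propositions, each unavoidable under the
tree's definitions (`IsOfHodgeType n X k p q c := ∃ A : HodgeModel n X, …`: the printed proof moves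
the class to an auxiliary variety `X × ℙʳ` of another dimension, which must be given a Hodge model —
a natural de Rham comparison family on the larger model space (de Rham) with the Hodge
decomposition on `X(ℂ) × ℙʳ(ℂ)` — and whose Hodge types must be compared with those of the GIVEN
model of `X` across different model spaces (rigidity)):

1. `Literature.NumberTheory.Transcendental.exists_deRhamIsoFamily 𝓘(ℝ, E)` for every
   finite-dimensional complex `E` (de Rham 1931; Warner Thm. 5.36 / 5.45);
2. `Literature.AlgebraicGeometry.Motives.isInternal_hodgePQ` (the Hodge decomposition of compact
   Kähler manifolds; Voisin I §6.1.3 Prop. 6.11);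
3. `NaturalDeRhamComparisonRigidity` (`HodgeFiltrationModelsReduction`; folklore from Thom 1954,
   Thm. II.29 / Cor. II.30).

PROVED here (no new named fact, D-0026):

* `middleDimensionReduction_of_deRham_of_hodgeDecomposition_of_rigidity` — (1) ∧ (2) ∧ (3) ⟹
  `middleDimensionReduction`.

Hence the closed discharge `middleDimensionReduction_holds : middleDimensionReduction` is the
one-liner `middleDimensionReduction_of_deRham_of_hodgeDecomposition_of_rigidity ‹1› ‹2› ‹3›` as soon
as the three roots have their `_holds` theorems (equivalently
`middleDimensionReduction_of_exists_deRhamIsoFamily (fun _ _ ↦ nonempty_hodgeModel_holds)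
hodgePQ_independent_of_hodgeModel_holds ‹1›`), and belongs in this file.

## References

* [BrosnanFangNiePearlstein2009] P. Brosnan, H. Fang, Z. Nie, G. Pearlstein, Singularities of
  admissible normal functions, Invent. Math. 177 (2009), §6 Lemma 48 (arXiv:0711.0964, p. 13).
* [VoisinHodgeI2002] C. Voisin, Hodge Theory and Complex Algebraic Geometry I (2002), §5.3.2
  Thm. 5.29, §6.1.3 Prop. 6.11, §7.3.2.
* [WarnerGTM94] F. W. Warner, Foundations of Differentiable Manifolds and Lie Groups (1983),
  Thm. 5.36, Thm. 5.45.
* [SerreGAGA1956] J.-P. Serre, Géométrie algébrique et géométrie analytique, Ann. Inst. Fourier 6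
  (1956), §2 n°5 Prop. 2, n°7 Prop. 6.
* R. Thom, Quelques propriétés globales des variétés différentiables, Comment. Math. Helv. 28
  (1954), Thm. II.29, Cor. II.30.
-/

noncomputable section

open scoped Manifold ContDiff

namespace Literature.AlgebraicGeometry.HodgeTheory

section HodgeTheory

/-- **BFNP Lemma 48 from its three roots.** If (1) de Rham's theorem `exists_deRhamIsoFamily
𝓘(ℝ, E)` (a natural, multiplicative, normalised family `H^k_dR(M; ℝ) ≃ₗ[ℝ] Hᵏ(M; ℝ)` over the
Hausdorff σ-compact `C^∞` manifolds charted on `E`; Warner Thm. 5.36 / 5.45) holds for every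
finite-dimensional complex model space `E` with its underlying real structure, (2) compact Kähler
manifolds have the Hodge decomposition (`Motives.isInternal_hodgePQ`, Voisin I Prop. 6.11), and
(3) natural de Rham comparisons are rigid across diffeomorphisms
(`NaturalDeRhamComparisonRigidity`), then the named fact `middleDimensionReduction` holds: if every
rational middle-degree Hodge class on every even-dimensional smooth projective complex variety is
algebraic, then every rational `(p, p)`-class on every smooth projective complex variety is
algebraic. Assembly: (1) ∧ (2) give Hodge models of all smooth projective varieties
(`nonempty_hodgeModel_of_deRham_of_hodgeDecomposition`), (3) gives the independence of `H^{p,q}`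
from the model (`hodgePQ_independent_of_hodgeModel_of_naturalDeRhamComparisonRigidity`), and
`middleDimensionReduction_of_nonempty_hodgeModel` is the formalised printed proof (products with
`ℙʳ`, Gysin maps of slices and projections, projection formula), its cup products of Hodge
bidegree being `cupPreservesHodgeType_of_nonempty_hodgeModel` (by (1) again, multiplicative form) —
the same composition as `middleDimensionReduction_of_exists_deRhamIsoFamily` of
`MiddleDimensionReductionOfDeRham`, one level further down. [cite: BrosnanFangNiePearlstein2009, §6 Lemma 48]
[cite: VoisinHodgeI2002, §6.1.3 Prop. 6.11 and §7.3.2] [cite: WarnerGTM94, Thm. 5.36 / Thm. 5.45] -/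
theorem middleDimensionReduction_of_deRham_of_hodgeDecomposition_of_rigidity
    (hdR : ∀ (E : Type) [NormedAddCommGroup E] [NormedSpace ℂ E] [FiniteDimensional ℂ E],
      Literature.NumberTheory.Transcendental.exists_deRhamIsoFamily 𝓘(ℝ, E))
    (hHD : ∀ (E : Type) [NormedAddCommGroup E] [NormedSpace ℂ E] [FiniteDimensional ℂ E]
      (M : Type) [TopologicalSpace M] [ChartedSpace E M] [IsManifold 𝓘(ℝ, E) ∞ M],
      Motives.isInternal_hodgePQ (E := E) (M := M))
    (hR : NaturalDeRhamComparisonRigidity) :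
    middleDimensionReduction :=
  have hA : ∀ ⦃n : ℕ⦄ ⦃X : Motives.SchemeOver ℂ⦄, nonempty_hodgeModel n X :=
    fun n X ↦ nonempty_hodgeModel_of_deRham_of_hodgeDecomposition hdR hHD n X
  have hI : hodgePQ_independent_of_hodgeModel :=
    hodgePQ_independent_of_hodgeModel_of_naturalDeRhamComparisonRigidity hR
  middleDimensionReduction_of_nonempty_hodgeModel hA hI
    fun _ _ hX ↦ cupPreservesHodgeType_of_nonempty_hodgeModel hI (@hA _ _) hdR hX

/-- The same assembly read as the full Hodge conjecture for one `X`: under the three roots, the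
middle-dimensional statement gives `HodgeConjectureFor n X` (both conjuncts: the Hodge model by
(1) ∧ (2), the cycle statement by the reduction) for every smooth projective `X` of any dimension
`n` (sanity: the assembled fact plugs into the tree's statement, cf.
`hodgeConjectureFor_of_middleDimension`). [cite: BrosnanFangNiePearlstein2009, §6 Lemma 48] -/
theorem hodgeConjectureFor_of_middleDimension_of_deRham_of_hodgeDecomposition_of_rigidity
    (hdR : ∀ (E : Type) [NormedAddCommGroup E] [NormedSpace ℂ E] [FiniteDimensional ℂ E],
      Literature.NumberTheory.Transcendental.exists_deRhamIsoFamily 𝓘(ℝ, E))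
    (hHD : ∀ (E : Type) [NormedAddCommGroup E] [NormedSpace ℂ E] [FiniteDimensional ℂ E]
      (M : Type) [TopologicalSpace M] [ChartedSpace E M] [IsManifold 𝓘(ℝ, E) ∞ M],
      Motives.isInternal_hodgePQ (E := E) (M := M))
    (hR : NaturalDeRhamComparisonRigidity)
    (hmid : ∀ ⦃m : ℕ⦄ ⦃X : Motives.SchemeOver ℂ⦄, Motives.IsSmoothProjective (2 * m) X →
      ∀ c : complexBetti X (2 * m), IsRationalClass c → IsOfHodgeType (2 * m) X (2 * m) m m c →
        c ∈ algebraicClasses X m)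
    {n : ℕ} {X : Motives.SchemeOver ℂ} (hX : Motives.IsSmoothProjective n X) :
    HodgeConjectureFor n X :=
  hodgeConjectureFor_of_middleDimension
    (middleDimensionReduction_of_deRham_of_hodgeDecomposition_of_rigidity hdR hHD hR)
    (fun n X hX' ↦ nonempty_hodgeModel_of_deRham_of_hodgeDecomposition hdR hHD n X hX') hmid hX

end HodgeTheory

end Literature.AlgebraicGeometry.HodgeTheory

end
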